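import Mathlib
import Summits.Parity.GeneralizedHardyLittlewood.Theses.LiouvilleMAD
import Literature.NumberTheory.LFunctions.QuasiRHFacts
import Literature.NumberTheory.LFunctions.LittlewoodCriterion

/-!
# Sketch (crux-ideate, ideator 2, round 1) — crux stmt-Parity-13322 `LiouvilleMAD.TypeIILiouville`

Card `resonance-converse-qgrh`: the RESONANCE CONVERSE.  The crux's free coefficients
(β = indicator of the primes p ∼ N, α = a dyadic block, Mellin-twisted) turn the bilinear bound into
a 1/p-DILUTED Bombieri–Vinogradov sum whose principal-character part is the plain sum
`M_λ(y) = Σ_{k ≤ y} λ(k)` (times `Σ_p 1/(p-1) ≍ 1/log N`) and whose non-principal part is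
UNCONDITIONALLY power-small (log-free density + Borel–Carathéodory, both PROVED in tree).  Hence the
crux forces `M_λ(y) ≪ y^{1-δ}`, i.e. a zero-free half-plane for ζ (and, with classes mod q₁, for
every Dirichlet L-function with the SAME δ: no exceptional zeros).  First-lemma signatures only.
-/

noncomputable section

namespace Summit.Parity.GeneralizedHardyLittlewood.Cruxes.TypeIILiouville.ResonanceConverse

open Finset ArithmeticFunction Filter Asymptotics
open Literature.NumberTheory.LFunctions

/-- Power-saving partial sums of the Liouville function: `|Σ_{k ≤ x} λ(k)| ≤ C x^{1-δ}` for large `x`. -/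
def PowerSavingLiouville (δ : ℝ) : Prop :=
  ∃ C x₀ : ℝ, ∀ x : ℝ, x₀ ≤ x → |∑ k ∈ Icc 1 ⌊x⌋₊, (liouville k : ℝ)| ≤ C * x ^ (1 - δ)

/-- Power-saving Mertens function (tree: `mertensFunction`). -/
def PowerSavingMertens (δ : ℝ) : Prop :=
  ∃ C x₀ : ℝ, ∀ x : ℝ, x₀ ≤ x → |(mertensFunction x : ℝ)| ≤ C * x ^ (1 - δ)

/-- The prime-dilated one-class sum the crux controls (β = 𝟙_{primes in (N,2N]}, α = blocks):
`Q_N(y) = Σ_{N < p ≤ 2N, p prime} Σ_{k ≤ y, k ≡ c (mod p)} λ(k)`. -/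
def primeClassSum (c : ℤ) (N : ℕ) (y : ℝ) : ℝ :=
  ∑ p ∈ (Ioc N (2 * N)).filter Nat.Prime,
    ∑ k ∈ (Icc 1 ⌊y⌋₊).filter (fun k : ℕ => (k : ℤ) ≡ c [ZMOD (p : ℤ)]), (liouville k : ℝ)

/-- STEP A (the only place the crux is used): dyadic blocks `M ≍ y/N ≥ N^{1/(2η)}`, separation of
the cutoff `mp + c ≤ y` (one `log y`), and `‖α‖‖β‖√(MN)(N^{-1/2}+M^{-η}) ≤ 2MN^{1/2}`:
`TypeIILiouville ⇒ |Q_N(y)| ≤ C y N^{-1/2} log y` for `y ≥ N^K`. -/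
def CruxToPrimeClassSum : Prop :=
  Theses.LiouvilleMAD.TypeIILiouville →
    ∀ c : ℤ, c ≠ 0 → ∃ K : ℕ, ∃ C : ℝ, ∀ N : ℕ, 2 ≤ N → ∀ y : ℝ, (N : ℝ) ^ K ≤ y →
      |primeClassSum c N y| ≤ C * y * (N : ℝ) ^ (-(1 / 2 : ℝ)) * Real.log y

/-- The NON-PRINCIPAL remainder, written without characters: by orthogonality mod `p` (for
`p ∤ c`) the principal-character share of the class `c (mod p)` is `(1/(p-1)) Σ_{k ≤ y, p ∤ k} λ(k)`;
the remainder collects the `p - 2` non-principal characters, each with weight `1/(p-1)`. -/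
def dilutedRemainder (c : ℤ) (N : ℕ) (y : ℝ) : ℝ :=
  primeClassSum c N y -
    ∑ p ∈ (Ioc N (2 * N)).filter Nat.Prime,
      (1 / ((p : ℝ) - 1)) * ∑ k ∈ (Icc 1 ⌊y⌋₊).filter (fun k : ℕ => ¬ (p ∣ k)), (liouville k : ℝ)

/-- LEMMA (U) — unconditional dilution of the non-principal characters (the new input; its two
analytic ingredients are PROVED in tree: `LogFreeDensity.logFreeDensity_dirichlet` (Bombieri,
Théorème 14) and `InvLFunctionDisc.norm_inv_LFunction_le_exp_of_line` (Borel–Carathéodory)):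
characters mod `p ∼ N` with a zero in `[1-δ₀,1] × [-N^5, N^5]` are `≪ N^{c_D δ₀}` in number and
cost `≤ y/(p-1)` each; the others have `Σ_{k≤y} λχ(k) ≪ y^{1-δ₀/2} N^{O(1/δ₀)}`; so for
`N^K ≤ y ≤ N^{K+1}`, `K ≥ K₀`, the remainder is `≪ y N^{-δ}`. -/
def NonPrincipalDilution : Prop :=
  ∀ c : ℤ, c ≠ 0 → ∃ K₀ : ℕ, ∀ K : ℕ, K₀ ≤ K → ∃ δ : ℝ, 0 < δ ∧ ∃ C : ℝ, ∃ N₀ : ℕ,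
    ∀ N : ℕ, N₀ ≤ N → ∀ y : ℝ, (N : ℝ) ^ K ≤ y → y ≤ (N : ℝ) ^ (K + 1) →
      |dilutedRemainder c N y| ≤ C * y * (N : ℝ) ^ (-δ)

/-- STEP C (elementary assembly): `Σ_{k≤y, p∤k} λ(k) = M_λ(y) + M_λ(y/p)` (λ(p) = -1), so
`(Σ_p 1/(p-1))·M_λ(y) = Q_N(y) − R_N(y) − Σ_p M_λ(y/p)/(p-1)` with `Σ_p 1/(p-1) ≫ 1/log N` and
`|Σ_p M_λ(y/p)/(p-1)| ≤ 2y/N`; choosing `N ≍ y^{1/(K+1/2)}` gives a power saving for `M_λ`. -/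
def AssemblyStep : Prop :=
  CruxToPrimeClassSum → NonPrincipalDilution → Theses.LiouvilleMAD.TypeIILiouville →
    ∃ δ : ℝ, 0 < δ ∧ δ < 1 / 2 ∧ PowerSavingLiouville δ

/-- STEP D (elementary): `μ = λ ⋆ (d ↦ μ(√d)𝟙_□(d))`, so `M_μ(x) = Σ_{d ≤ √x} μ(d) M_λ(x/d²)` and a
power saving `δ < 1/2` transfers from `λ` to `μ`. -/
def LiouvilleToMertens : Prop :=
  ∀ δ : ℝ, 0 < δ → δ < 1 / 2 → PowerSavingLiouville δ → PowerSavingMertens δ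

/-- STEP E is IN TREE (Landau–Littlewood–Titchmarsh, PROVED:
`quasiRiemannHypothesis_of_mertens_isBigO_holds`): a power-saving Mertens bound is a zero-free
half-plane. -/
theorem stepE {δ : ℝ} (hδ0 : 0 < δ) (hδ1 : δ < 1) (h : PowerSavingMertens δ) :
    QuasiRiemannHypothesis (1 - δ) := by
  refine quasiRiemannHypothesis_of_mertens_isBigO_holds (1 - δ) (by linarith) (by linarith) ?_
  obtain ⟨C, x₀, hC⟩ := h
  rw [Asymptotics.isBigO_iff]
  refine ⟨C, ?_⟩
  filter_upwards [eventually_ge_atTop x₀, eventually_ge_atTop (0 : ℝ)] with x hx hx0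
  rw [Real.norm_eq_abs, Real.norm_eq_abs, abs_of_nonneg (Real.rpow_nonneg hx0 _)]
  exact hC x hx

/-- THE CONVERSE (target of the negative line): the crux is a zero-free half-plane in disguise. -/
theorem typeII_implies_quasiRH (hA : AssemblyStep) (hD : LiouvilleToMertens)
    (hQ : CruxToPrimeClassSum) (hU : NonPrincipalDilution)
    (hcrux : Theses.LiouvilleMAD.TypeIILiouville) :
    ∃ δ : ℝ, 0 < δ ∧ QuasiRiemannHypothesis (1 - δ) := by
  obtain ⟨δ, hδ0, hδ2, hL⟩ := hA hQ hU hcrux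
  exact ⟨δ, hδ0, stepE hδ0 (by linarith) (hD δ hδ0 hδ2 hL)⟩

/-- UPGRADE (same proof with α, β restricted to classes `m ≡ m₀`, `p ≡ n₀ (mod q₁)`, so that
`k = mp + c` runs over ONE class `a₁ = m₀n₀ + c (mod q₁)`): every Dirichlet `L(s, χ₁)` is zero-free
on `Re s > 1 - δ` with the SAME `δ = δ(c, η)` — in particular no Landau–Siegel zero. -/
def NoExceptionalZeros (δ : ℝ) : Prop :=
  ∀ (q : ℕ) [NeZero q] (χ : DirichletCharacter ℂ q) (s : ℂ),
    χ.LFunction s = 0 → 1 - δ < s.re → s.re < 1 → False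

/-- Target of the upgraded negative line. -/
def UniformConverseTarget : Prop :=
  Theses.LiouvilleMAD.TypeIILiouville → ∃ δ : ℝ, 0 < δ ∧ NoExceptionalZeros δ

end Summit.Parity.GeneralizedHardyLittlewood.Cruxes.TypeIILiouville.ResonanceConverse

end
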